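import Mathlib
import HarnessLib
import Summits.Ventures.LatticeQCDFlow.Exactness.PseudoMarginalFlowSampler
import Summits.Ventures.LatticeQCDFlow.Exactness.IMHMultiProposalMinorisation
import Summits.Ventures.LatticeQCDFlow.Exactness.IMHMultiProposalPoolEstimator
import Summits.Ventures.LatticeQCDFlow.Exactness.RefreshScan

/-!
# The ENSEMBLE flow sampler with NOISY weights is exact: pool selection among `n` fresh (configuration, noise) proposals and the current pair,
# with positive unbiased weight estimates, leaves the extended target invariant, samples the configuration law `π` exactly, converges from
# every start at the batch rate for bounded estimates, and its pool-weighted read-out of configuration observables is unbiased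

HONEST FRAMING: exact (Metropolis-corrected) sampling algorithms for lattice gauge theory;
figures of merit are autocorrelation/cost numbers at stated couplings and volumes; no
continuum-physics claim.

Venture `LatticeQCDFlow` (cell pub-lqcd), topic `Exactness`; FANOUT row 30 (lean-1, GEN-42).  NEW WORK of the cell: the composition of this
generation's `PseudoMarginalFlowSampler` (the extended target `π̂ = ŵ·(q ⊗ₘ κ)` has configuration marginal `π = w·q`) with GEN-41's def-free
multi-proposal files on the extended space `Ω × U` (`IMHMultiProposalExact.multiProposal_invariant`, `IMHMultiProposalMinorisation.
multiProposal_uniformlyErgodic`, `IMHMultiProposalPoolEstimator.multiProposal_poolAverage_lintegral_eq`).  This is the architecture of the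
batched flow samplers with pseudofermions (many gauge proposals per update, each with its own stochastic determinant estimate); nothing is cited
as a fact.

## Setting
`q` flow law on `Ω`, `κ : Kernel Ω U` noise law, `ŵ : Ω × U → ℝ` positive measurable, unbiased for `w` (`∫ ŵ(x, u) κ_x(du) = w(x)`), `π = w·q`,
`π̂ = ŵ·(q ⊗ₘ κ)`; `P` any Markov kernel on `Ω × U` satisfying the pool-selection equation with proposal law `q ⊗ₘ κ` and weight `ŵ`
(GEN-41's `hP`, here with `m + 1` fresh proposals: from `(x, u)` draw `(y_i, u_i) ∼ q ⊗ₘ κ` independently, move to pool member `j` with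
probability `ŵ(z_j)/Σ_i ŵ(z_i)`).

## Results (no `sorry`, no new definitions)
* `pseudoMarginal_isProbability` — `π̂` is a probability law when `π` is.
* **`pseudoMarginal_multiProposal_invariant`** — `∫ P(z, B) π̂(dz) = π̂(B)`: exact on the extended space for EVERY flow, noise law, positive unbiased
  estimator and batch size; **`pseudoMarginal_multiProposal_configuration_invariant`** — `∫ P(z, A × U) π̂(dz) = π(A)`: the configuration law is
  exactly `π`.
* **`pseudoMarginal_multiProposal_uniformlyErgodic_fst`** — for a bounded estimate `ŵ ≤ Ŵ`: `|μ₀Pᵗ(A × U) − π(A)| ≤ (1 − (m + 1)/(2Ŵ + m))ᵗ`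
  from EVERY initial law: the batch rate with the ESTIMATOR's bound in place of the weight's (`Ŵ ≥ sup w` necessarily — noise slows, see
  `PseudoMarginalFlowSampler` §3).
* `pseudoMarginal_uniformlyErgodic_fst` ∕ `_real` — for comparison, the single-proposal noisy run `indepMH (q ⊗ₘ κ) ŵ` with `ŵ ≤ Ŵ`:
  `|μ₀K̂ᵗ(A × U) − π(A)| ≤ (1 − 1/Ŵ)ᵗ` from every start (Doeblin on the extended space + the marginal identity).
* **`pseudoMarginal_multiProposal_poolAverage_eq`** — at equilibrium the pool-weighted average `Σ_j ŵ(z_j)g(x_j)/Σ_i ŵ(z_i)` of a configuration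
  observable `g ≥ 0`, computed with the NOISY weights, has expectation EXACTLY `∫ g dπ`.
Reading (gauge files with fermions): propose a batch of gauge fields from the flow, attach to each a fresh stochastic estimate of
`det D`, resample one of batch-plus-current `∝ e^{−S_g}·(estimate)/q̃`, and report the estimate-weighted batch average: the chain is exact for
the full-QCD weight and the read-out unbiased, whatever the flow and the estimator's noise.  NOT CLAIMED: rates for unbounded estimates; the
`N_pf`-dependence of `Ŵ`.
-/

noncomputable section

namespace Summit.Ventures.LatticeQCDFlow.Exactness

open MeasureTheory ProbabilityTheory Function Finset
open scoped ENNReal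

variable {Ω U : Type*} [MeasurableSpace Ω] [MeasurableSpace U]
  {q : Measure Ω} [IsProbabilityMeasure q] {κ : Kernel Ω U} [IsMarkovKernel κ]
  {w : Ω → ℝ} {west : Ω × U → ℝ} {m : ℕ}

/-- `π̂ = ŵ·(q ⊗ₘ κ)` is a probability law when `π = w·q` is. [ours, bookkeeping] -/
theorem pseudoMarginal_isProbability (hW : Measurable west)
    (hunb : ∀ x, ∫⁻ u, ENNReal.ofReal (west (x, u)) ∂(κ x) = ENNReal.ofReal (w x))
    [hπ : IsProbabilityMeasure (q.withDensity fun x => ENNReal.ofReal (w x))] :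
    IsProbabilityMeasure ((q ⊗ₘ κ).withDensity fun z => ENNReal.ofReal (west z)) :=
  ⟨by rw [pseudoMarginal_target_univ hW hunb]; exact measure_univ⟩

/-- **THE NOISY ENSEMBLE SAMPLER IS EXACT ON THE EXTENDED SPACE**: `∫ P(z, B) π̂(dz) = π̂(B)` for every measurable `B ⊆ Ω × U`.
[ours — GEN-41's `multiProposal_invariant` on `Ω × U`] -/
theorem pseudoMarginal_multiProposal_invariant (hW : Measurable west) (hW0 : ∀ z, 0 < west z) (P : Kernel (Ω × U) (Ω × U))
    (hP : ∀ (z : Ω × U) {B : Set (Ω × U)}, MeasurableSet B → P z B =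
      ∫⁻ y, (∑ j, ENNReal.ofReal (west (Fin.cons (α := fun _ : Fin (m + 2) => Ω × U) z y j)) *
        B.indicator (fun _ => (1 : ℝ≥0∞)) (Fin.cons (α := fun _ : Fin (m + 2) => Ω × U) z y j)) /
        (∑ i, ENNReal.ofReal (west (Fin.cons (α := fun _ : Fin (m + 2) => Ω × U) z y i))) ∂(Measure.pi fun _ : Fin (m + 1) => q ⊗ₘ κ))
    {B : Set (Ω × U)} (hB : MeasurableSet B) :
    ∫⁻ z, P z B ∂((q ⊗ₘ κ).withDensity fun z => ENNReal.ofReal (west z)) = ((q ⊗ₘ κ).withDensity fun z => ENNReal.ofReal (west z)) B :=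
  multiProposal_invariant hW hW0 P hP hB

/-- **… AND SAMPLES THE CONFIGURATION LAW EXACTLY**: `∫ P(z, A × U) π̂(dz) = π(A)` for every measurable `A ⊆ Ω`. [ours] -/
theorem pseudoMarginal_multiProposal_configuration_invariant (hW : Measurable west) (hW0 : ∀ z, 0 < west z)
    (hunb : ∀ x, ∫⁻ u, ENNReal.ofReal (west (x, u)) ∂(κ x) = ENNReal.ofReal (w x)) (P : Kernel (Ω × U) (Ω × U))
    (hP : ∀ (z : Ω × U) {B : Set (Ω × U)}, MeasurableSet B → P z B =
      ∫⁻ y, (∑ j, ENNReal.ofReal (west (Fin.cons (α := fun _ : Fin (m + 2) => Ω × U) z y j)) *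
        B.indicator (fun _ => (1 : ℝ≥0∞)) (Fin.cons (α := fun _ : Fin (m + 2) => Ω × U) z y j)) /
        (∑ i, ENNReal.ofReal (west (Fin.cons (α := fun _ : Fin (m + 2) => Ω × U) z y i))) ∂(Measure.pi fun _ : Fin (m + 1) => q ⊗ₘ κ))
    {A : Set Ω} (hA : MeasurableSet A) :
    ∫⁻ z, P z (Prod.fst ⁻¹' A) ∂((q ⊗ₘ κ).withDensity fun z => ENNReal.ofReal (west z)) = (q.withDensity fun x => ENNReal.ofReal (w x)) A := by
  rw [pseudoMarginal_multiProposal_invariant hW hW0 P hP (measurable_fst hA), pseudoMarginal_target_apply_fst hW hunb hA]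

/-- **THE BATCH RATE WITH NOISY WEIGHTS**: for a bounded positive unbiased estimate `ŵ ≤ Ŵ` and `m + 1` fresh (configuration, noise) proposals
per update, `|μ₀Pᵗ(A × U) − π(A)| ≤ (1 − (m + 1)/(2Ŵ + m))ᵗ` from EVERY initial law `μ₀` on `Ω × U`. [ours — GEN-41's
`multiProposal_uniformlyErgodic` on `Ω × U` + the marginal identity] -/
theorem pseudoMarginal_multiProposal_uniformlyErgodic_fst (hW : Measurable west) (hW0 : ∀ z, 0 < west z) {West : ℝ}
    (hWW : ∀ z, west z ≤ West) (hunb : ∀ x, ∫⁻ u, ENNReal.ofReal (west (x, u)) ∂(κ x) = ENNReal.ofReal (w x))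
    [IsProbabilityMeasure (q.withDensity fun x => ENNReal.ofReal (w x))] (P : Kernel (Ω × U) (Ω × U))
    (hP : ∀ (z : Ω × U) {B : Set (Ω × U)}, MeasurableSet B → P z B =
      ∫⁻ y, (∑ j, ENNReal.ofReal (west (Fin.cons (α := fun _ : Fin (m + 2) => Ω × U) z y j)) *
        B.indicator (fun _ => (1 : ℝ≥0∞)) (Fin.cons (α := fun _ : Fin (m + 2) => Ω × U) z y j)) /
        (∑ i, ENNReal.ofReal (west (Fin.cons (α := fun _ : Fin (m + 2) => Ω × U) z y i))) ∂(Measure.pi fun _ : Fin (m + 1) => q ⊗ₘ κ))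
    (μ₀ : Measure (Ω × U)) [IsProbabilityMeasure μ₀] (t : ℕ) {A : Set Ω} (hA : MeasurableSet A) :
    |((fun ν : Measure (Ω × U) => ν.bind P)^[t] μ₀).real (Prod.fst ⁻¹' A) - (q.withDensity fun x => ENNReal.ofReal (w x)).real A| ≤
      (1 - (m + 1) / (2 * West + m)) ^ t := by
  haveI := pseudoMarginal_isProbability (q := q) (κ := κ) hW hunb
  have h := multiProposal_uniformlyErgodic (q := q ⊗ₘ κ) hW hW0 hWW P hP μ₀ t (Prod.fst ⁻¹' A)
  rwa [measureReal_def (μ := (q ⊗ₘ κ).withDensity fun z => ENNReal.ofReal (west z)), pseudoMarginal_target_apply_fst hW hunb hA,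
    ← measureReal_def] at h

/-- **THE NOISY POOL READ-OUT IS UNBIASED FOR CONFIGURATION OBSERVABLES**: at equilibrium (`(x, u) ∼ π̂`, `m + 1`… here `n` fresh proposals
`∼ (q ⊗ₘ κ)^{⊗n}`), the estimate-weighted pool average of `g(configuration)` has expectation exactly `∫ g dπ`, for every measurable `g ≥ 0`.
[ours — GEN-41's `multiProposal_poolAverage_lintegral_eq` on `Ω × U` + the marginal identity] -/
theorem pseudoMarginal_multiProposal_poolAverage_eq {n : ℕ} (hW : Measurable west) (hW0 : ∀ z, 0 < west z)
    (hunb : ∀ x, ∫⁻ u, ENNReal.ofReal (west (x, u)) ∂(κ x) = ENNReal.ofReal (w x)) {g : Ω → ℝ≥0∞} (hg : Measurable g) :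
    ∫⁻ z, ∫⁻ y, (∑ j, ENNReal.ofReal (west (Fin.cons (α := fun _ : Fin (n + 1) => Ω × U) z y j)) *
        g (Fin.cons (α := fun _ : Fin (n + 1) => Ω × U) z y j).1) / (∑ i, ENNReal.ofReal (west (Fin.cons (α := fun _ : Fin (n + 1) => Ω × U) z y i)))
        ∂(Measure.pi fun _ : Fin n => q ⊗ₘ κ) ∂((q ⊗ₘ κ).withDensity fun z => ENNReal.ofReal (west z)) =
      ∫⁻ x, g x ∂(q.withDensity fun x => ENNReal.ofReal (w x)) := by
  have h := multiProposal_poolAverage_lintegral_eq (q := q ⊗ₘ κ) (n := n) hW hW0 (hg.comp measurable_fst)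
  simp only [Function.comp] at h
  rw [h]
  exact pseudoMarginal_lintegral_comp_fst hW hunb hg

/-! ## The single-proposal noisy sampler's rate, for comparison -/

/-- **THE SINGLE-PROPOSAL PSEUDO-MARGINAL RATE**: for a bounded positive unbiased estimate `ŵ ≤ Ŵ` the run `indepMH (q ⊗ₘ κ) ŵ` satisfies
`|μ₀K̂ᵗ(A × U) − π(A)| ≤ (1 − 1/Ŵ)ᵗ` from EVERY initial law on `Ω × U` (the tree's Doeblin bound `IMHKernel.indepMH_apply_ge` on the extended
space + `RefreshScan.uniformlyErgodic_of_minorised` + the marginal identity); the batch version above improves `1/Ŵ` to `(m + 1)/(2Ŵ + m)`.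
[ours] -/
theorem pseudoMarginal_uniformlyErgodic_fst (hW : Measurable west) (hW0 : ∀ z, 0 < west z) {West : ℝ} (hWW : ∀ z, west z ≤ West)
    (hunb : ∀ x, ∫⁻ u, ENNReal.ofReal (west (x, u)) ∂(κ x) = ENNReal.ofReal (w x))
    [IsProbabilityMeasure (q.withDensity fun x => ENNReal.ofReal (w x))] (μ₀ : Measure (Ω × U)) [IsProbabilityMeasure μ₀] (t : ℕ)
    {A : Set Ω} (hA : MeasurableSet A) :
    haveI : Fact (Measurable west) := ⟨hW⟩
    |((fun ν : Measure (Ω × U) => ν.bind (indepMH (q ⊗ₘ κ) west))^[t] μ₀).real (Prod.fst ⁻¹' A) -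
        (q.withDensity fun x => ENNReal.ofReal (w x)).real A| ≤ (1 - (ENNReal.ofReal West)⁻¹.toReal) ^ t := by
  haveI : Fact (Measurable west) := ⟨hW⟩
  haveI := pseudoMarginal_isProbability (q := q) (κ := κ) hW hunb
  have hmin : ∀ z : Ω × U, (ENNReal.ofReal West)⁻¹ • ((q ⊗ₘ κ).withDensity fun z => ENNReal.ofReal (west z)) ≤ indepMH (q ⊗ₘ κ) west z :=
    fun z => by
      rw [Measure.le_iff]
      intro B hB
      rw [Measure.smul_apply, smul_eq_mul]
      exact indepMH_apply_ge hW hW0 hWW z hB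
  have h := uniformlyErgodic_of_minorised hmin (pseudoMarginal_invariant hW hW0) μ₀ t (Prod.fst ⁻¹' A)
  rwa [measureReal_def (μ := (q ⊗ₘ κ).withDensity fun z => ENNReal.ofReal (west z)), pseudoMarginal_target_apply_fst hW hunb hA,
    ← measureReal_def] at h

/-- … with the rate as a real number: `(1 − 1/Ŵ)ᵗ`. [ours] -/
theorem pseudoMarginal_uniformlyErgodic_fst_real (hW : Measurable west) (hW0 : ∀ z, 0 < west z) {West : ℝ} (hWW : ∀ z, west z ≤ West)
    (hunb : ∀ x, ∫⁻ u, ENNReal.ofReal (west (x, u)) ∂(κ x) = ENNReal.ofReal (w x))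
    [IsProbabilityMeasure (q.withDensity fun x => ENNReal.ofReal (w x))] (μ₀ : Measure (Ω × U)) [IsProbabilityMeasure μ₀] (t : ℕ)
    {A : Set Ω} (hA : MeasurableSet A) :
    haveI : Fact (Measurable west) := ⟨hW⟩
    |((fun ν : Measure (Ω × U) => ν.bind (indepMH (q ⊗ₘ κ) west))^[t] μ₀).real (Prod.fst ⁻¹' A) -
        (q.withDensity fun x => ENNReal.ofReal (w x)).real A| ≤ (1 - 1 / West) ^ t := by
  obtain ⟨z₀⟩ := nonempty_of_isProbabilityMeasure μ₀
  have hWpos : 0 < West := (hW0 z₀).trans_le (hWW z₀)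
  have h := pseudoMarginal_uniformlyErgodic_fst (q := q) (κ := κ) hW hW0 hWW hunb μ₀ t hA
  rwa [ENNReal.toReal_inv, ENNReal.toReal_ofReal hWpos.le, inv_eq_one_div] at h

end Summit.Ventures.LatticeQCDFlow.Exactness
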